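import Literature.AlgebraicGeometry.Resolution.KedlayaEtaleCovers
import Literature.AlgebraicGeometry.Motives.ProjectiveNoetherNormalization
import Mathlib.AlgebraicGeometry.Morphisms.Etale
import Mathlib.AlgebraicGeometry.Morphisms.FormallyUnramified
import Mathlib.RingTheory.Unramified.Field

/-!
# `WeightedInvariant.WeightedThesis`, line `datum-glued-split`, stub A-of-K:
# finite separable projections `X → ℙ^d_k` from Kedlaya's theorem

Route `ResolutionOfSingularities/WeightedInvariant`, crux `WeightedThesis`
(stmt-ResolutionOfSingularities-0569), RESHAPE 4, stub `stub_separableProjection_of_kedlaya` of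
the lead's skeleton `work/WeightedThesis.lean`, PROVED here (statement verbatim from the ledger
registration).

**Statement.** Assume the tree's named fact
`Literature.AlgebraicGeometry.Resolution.Kedlaya2004_finite_etale_off_hyperplane` (Kedlaya,
*More étale covers of affine spaces in positive characteristic*, J. Algebraic Geom. 14 (2005),
Thm. 1, in its vendored specialisation: every integral scheme finite over some `ℙᴺ_k`, `k`
perfect of characteristic `p`, is a finite surjective cover `f : X → ℙ^d_k` over `k`, étale over
the standard chart `D₊(x_d)`). Then every integral closed subscheme `ι : X ↪ ℙⁿ_k` admits a
finite surjective `k`-morphism `ψ : X → ℙ^d_k` with `d = dim X` along which `K(X)` is a finite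
**separable** extension of `K(ℙ^d)` (through `ψ^♯ = RatFn.functionFieldMap ψ`).

**Proof.** Take `ψ := f` from Kedlaya's theorem (a closed immersion is finite). Then
`dim X = dim ℙ^d = d` for the finite surjective `ψ` (Stacks 0ECG,
`Motives.Scheme.topologicalKrullDim_eq_of_isFinite_of_surjective`,
`ProjSpace.topologicalKrullDim_eq`); `K(X)/K(ℙ^d)` is finite for the finite dominant `ψ`
(`Motives.FunctionFieldOver.instFiniteDimensional`); and it is separable because `ψ` is étale
over `D₊(x_d) ∋ η_{ℙ^d} = ψ(η_X)`: the stalk map `𝒪_{ℙ^d, η} → 𝒪_{X, η_X} = K(X)` is that of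
the étale restriction `ψ ∣_ D₊(x_d)` up to isomorphism (Mathlib `morphismRestrictStalkMap`),
hence formally unramified (Mathlib `FormallyUnramified.stalkMap`), so `ψ^♯ : K(ℙ^d) → K(X)` is
formally unramified, and a formally unramified extension of fields essentially of finite type
is separable (Mathlib `Algebra.FormallyUnramified.isSeparable`, Stacks 00UW).
-/

noncomputable section

set_option linter.dupNamespace false -- mandated namespace of this single-conjunct summit

open CategoryTheory AlgebraicGeometry

namespace Summit.ResolutionOfSingularities.ResolutionOfSingularities.Theorems.WeightedThesis.HypersurfaceModel

namespace SeparableProjectionOfKedlaya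

universe u

open Literature.AlgebraicGeometry.Motives.RatFn

/-! ## Function field extensions of dominant morphisms étale at the generic point -/

/-- **`ψ^♯ : K(Y) → K(X)` is formally unramified when `ψ` is formally unramified over an open
containing the generic point of `Y`.** For a dominant morphism `f : X → Y` of integral schemes
and an open `U ∋ η_Y` with `f ∣_ U` formally unramified, the field map `RatFn.functionFieldMap f`
is formally unramified: it is the stalk map of `f` at `η_X` (which lies over `η_Y`) composed
with a specialisation isomorphism, and that stalk map is, up to an isomorphism of arrows
(`morphismRestrictStalkMap`), the stalk map of `f ∣_ U`, formally unramified by Mathlib's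
`FormallyUnramified.stalkMap`. [folklore] -/
theorem formallyUnramified_functionFieldMap {X Y : Scheme.{u}} [IsIntegral X] [IsIntegral Y]
    (f : X ⟶ Y) [IsDominant f] (U : Y.Opens) [FormallyUnramified (f ∣_ U)]
    (hU : genericPoint Y ∈ U) : (functionFieldMap f).FormallyUnramified := by
  have hξ : f (genericPoint X) = genericPoint Y := genericPoint_eq_of_isDominant f
  have hξU : genericPoint X ∈ f ⁻¹ᵁ U := by
    show f (genericPoint X) ∈ U
    rw [hξ]
    exact hU
  have hP : (RingHom.toMorphismProperty RingHom.FormallyUnramified).RespectsIso :=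
    RingHom.toMorphismProperty_respectsIso_iff.mp RingHom.FormallyUnramified.respectsIso
  have h1 : (f.stalkMap (genericPoint X)).hom.FormallyUnramified :=
    ((RingHom.toMorphismProperty RingHom.FormallyUnramified).arrow_mk_iso_iff
      (morphismRestrictStalkMap f U ⟨genericPoint X, hξU⟩)).mp
      (FormallyUnramified.stalkMap (f ∣_ U) ⟨genericPoint X, hξU⟩)
  have h2 : IsIso (Y.presheaf.stalkSpecializes (specializes_genericPoint f)) :=
    (Y.presheaf.stalkCongr (Inseparable.of_eq hξ.symm)).isIso_hom
  show ((Y.presheaf.stalkSpecializes (specializes_genericPoint f)) ≫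
    f.stalkMap (genericPoint X)).hom.FormallyUnramified
  rw [CommRingCat.hom_comp,
    RingHom.FormallyUnramified.respectsIso.cancel_left_isIso]
  exact h1

/-- **Finite + generically unramified ⇒ finite separable function field extension.** For a finite
dominant morphism `f : X → Y` of integral schemes, formally unramified over an open containing the
generic point of `Y`, and any `K(Y)`-algebra structure on `K(X)` whose structure map is `f^♯`,
`K(X)/K(Y)` is separable and finite: finite by `Motives.FunctionFieldOver.instFiniteDimensional`,
separable since formally unramified field extensions essentially of finite type are separable
(Mathlib `Algebra.FormallyUnramified.isSeparable`). [folklore; cite: StacksProject, Tag 00UW] -/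
theorem isSeparable_and_finite_of_formallyUnramified_restrict {X Y : Scheme.{u}} [IsIntegral X]
    [IsIntegral Y] (f : X ⟶ Y) [IsDominant f] [IsFinite f] (U : Y.Opens)
    [FormallyUnramified (f ∣_ U)] (hU : genericPoint Y ∈ U)
    [Algebra Y.functionField X.functionField]
    (halg : algebraMap Y.functionField X.functionField = functionFieldMap f) :
    Algebra.IsSeparable Y.functionField X.functionField ∧
      Module.Finite Y.functionField X.functionField := by
  have hfin : (functionFieldMap f).Finite :=
    Literature.AlgebraicGeometry.Motives.FunctionFieldOver.instFiniteDimensional f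
  haveI : Module.Finite Y.functionField X.functionField := by
    rw [← RingHom.finite_algebraMap, halg]
    exact hfin
  haveI : Algebra.FormallyUnramified Y.functionField X.functionField := by
    rw [← RingHom.formallyUnramified_algebraMap, halg]
    exact formallyUnramified_functionFieldMap f U hU
  exact ⟨Algebra.FormallyUnramified.isSeparable _ _, ‹_›⟩

/-! ## The projection -/

open Literature.AlgebraicGeometry.Motives in
/-- **Finite separable projections from Kedlaya's theorem** (clean form). Assuming
`Kedlaya2004_finite_etale_off_hyperplane`, an integral closed subscheme `ι : X ↪ ℙⁿ_k` over a
perfect field `k` of characteristic `p` admits a finite surjective `k`-morphism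
`ψ : X → ℙ^d_k`, `d = dim X`, with `K(X)/K(ℙ^d)` finite separable through `ψ^♯`: `ψ` is
Kedlaya's cover, étale over `D₊(x_d) ∋ η`. [cite: Kedlaya2004, Thm 1] -/
theorem separableProjection_of_kedlaya
    (hK : Literature.AlgebraicGeometry.Resolution.Kedlaya2004_finite_etale_off_hyperplane.{u})
    {p : ℕ} (hp : p.Prime) (k : Type u) [Field k] [CharP k p] [PerfectField k] (n : ℕ)
    (X : Scheme.{u}) [IsIntegral X] (ι : X ⟶ (projectiveSpace n k).left) [IsClosedImmersion ι] :
    ∃ (d : ℕ) (ψ : X ⟶ ProjSpace.P d k) (_ : IsFinite ψ) (_ : Surjective ψ),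
      ψ ≫ Segre.toSpec (Fin (d + 1)) k = ι ≫ (projectiveSpace n k).hom ∧
      topologicalKrullDim X = d ∧
      ∀ [Algebra (ProjSpace.P d k).functionField X.functionField],
        algebraMap (ProjSpace.P d k).functionField X.functionField = functionFieldMap ψ →
        Algebra.IsSeparable (ProjSpace.P d k).functionField X.functionField ∧
          Module.Finite (ProjSpace.P d k).functionField X.functionField := by
  obtain ⟨d, f, hcomp, hfin, hsurj, het⟩ := hK p hp k n X ι inferInstance inferInstance
  letI := MvPolynomial.gradedAlgebra (σ := Fin (d + 1)) (R := k)
  change X ⟶ ProjSpace.P d k at f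
  haveI : IsFinite f := hfin
  haveI : Surjective f := ⟨hsurj⟩
  haveI : Etale (f ∣_ Proj.basicOpen (MvPolynomial.homogeneousSubmodule (Fin (d + 1)) k)
      (MvPolynomial.X (Fin.last d))) := het
  have hη : genericPoint (ProjSpace.P d k) ∈ Proj.basicOpen
      (MvPolynomial.homogeneousSubmodule (Fin (d + 1)) k) (MvPolynomial.X (Fin.last d)) :=
    genericPoint_mem_of_mem (ProjectiveSpace.genericPoint_mem_basicOpen d k (Fin.last d))
  refine ⟨d, f, hfin, ⟨hsurj⟩, hcomp, ?_, fun halg => ?_⟩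
  · rw [Literature.AlgebraicGeometry.Motives.Scheme.topologicalKrullDim_eq_of_isFinite_of_surjective
      f, ProjSpace.topologicalKrullDim_eq]
  · exact isSeparable_and_finite_of_formallyUnramified_restrict f _ hη halg

end SeparableProjectionOfKedlaya

/-- **Registered shape (universe `0`) of stub A-of-K** (`stub_separableProjection_of_kedlaya` of
the line `datum-glued-split`): finite separable projections `ψ : X → ℙ^d_k`, `d = dim X`, for
integral closed `X ⊆ ℙⁿ_k` over a perfect field of characteristic `p`, from the named fact
`Kedlaya2004_finite_etale_off_hyperplane`
(`SeparableProjectionOfKedlaya.separableProjection_of_kedlaya`). [cite: Kedlaya2004, Thm 1] -/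
theorem stub_separableProjection_of_kedlaya :
    Literature.AlgebraicGeometry.Resolution.Kedlaya2004_finite_etale_off_hyperplane.{0} →
    ∀ (p : ℕ), p.Prime → ∀ (k : Type) [Field k] [CharP k p] [PerfectField k] (n : ℕ)
      (X : AlgebraicGeometry.Scheme.{0}) [AlgebraicGeometry.IsIntegral X]
      (ι : X ⟶ (Literature.AlgebraicGeometry.Motives.projectiveSpace n k).left)
      [AlgebraicGeometry.IsClosedImmersion ι],
      ∃ (d : ℕ) (ψ : X ⟶ Literature.AlgebraicGeometry.Motives.ProjSpace.P d k)
        (_ : AlgebraicGeometry.IsFinite ψ) (_ : AlgebraicGeometry.Surjective ψ),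
        ψ ≫ Literature.AlgebraicGeometry.Motives.Segre.toSpec (Fin (d + 1)) k =
            ι ≫ (Literature.AlgebraicGeometry.Motives.projectiveSpace n k).hom ∧
        topologicalKrullDim X = d ∧
        ∀ [Algebra (Literature.AlgebraicGeometry.Motives.ProjSpace.P d k).functionField
            X.functionField],
          algebraMap (Literature.AlgebraicGeometry.Motives.ProjSpace.P d k).functionField
              X.functionField = Literature.AlgebraicGeometry.Motives.RatFn.functionFieldMap ψ →
          Algebra.IsSeparable (Literature.AlgebraicGeometry.Motives.ProjSpace.P d k).functionField
              X.functionField ∧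
            Module.Finite (Literature.AlgebraicGeometry.Motives.ProjSpace.P d k).functionField
              X.functionField :=
  fun hK _ hp k _ _ _ n X _ ι _ =>
    SeparableProjectionOfKedlaya.separableProjection_of_kedlaya hK hp k n X ι

end Summit.ResolutionOfSingularities.ResolutionOfSingularities.Theorems.WeightedThesis.HypersurfaceModel

end
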